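import Mathlib

/-!
# `KineticWindowGronwall`: cubic exponential moments of a Maxwellian diverge (method obstruction)

Negative knowledge for the crux `AntiMazurCoboundaries.KineticWindowGronwall` (stmt-AtomisticToContinuum-9282), from
the standing disprover's `Cruxes/KineticWindowGronwall/Disproof.lean` §4. The informal proof plan of the crux bounds
every current term of `dH(f_t|ψ_t)/dt` by the entropy inequality `∫ X df ≤ β⁻¹[H(f|ψ) + log ∫ e^{βX} dψ]`. For the
ENERGY current (one-body symbol `v|v|²/2`, cubic in `v`) and for the cubic velocity tail this is void under every
local Gibbs reference `ψ`: `∫ exp(α x³) dγ = ∞` for all `α > 0` already for the standard Gaussian `γ` on `ℝ`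
(`lintegral_exp_mul_pow_three_eq_top`; any Maxwellian by scaling, `v₁|v|² ≥ v₁³` on `v₁ ≥ 0`). The plan's "tail by a
truncation statement under f_t (GIVEN)" is therefore an a-priori estimate on the TRUE law outside the entropy method —
the tree's barrier `Literature.Barriers.AtomisticToContinuum.HighMomentumCutoff` (Olla–Varadhan–Yau 1993 p. 525:
bounded-gradient kinetic energy; Nachtergaele–Yau 2003 Assumption II.1) bites on this item.
refuter-cdisprove-stmt-AtomisticToContinuum-9282-0.
-/

noncomputable section

namespace Summit.AtomisticToContinuum.HydrodynamicLimit.Theorems.KineticWindowGronwallNegative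

open MeasureTheory Set
open scoped ENNReal

/-- **No Maxwellian has a finite exponential CUBIC moment**: `∫ exp(α x³) dγ(x) = ∞` for every `α > 0`
(`γ` the standard Gaussian on `ℝ`; by scaling the same holds for every centred or drifted Maxwellian of any
temperature, and — one component at a time, `v₁|v|² ≥ v₁³` on `v₁ ≥ 0` — for the one-body symbol `v|v|²/2` of
the ENERGY CURRENT in `ℝ³`). Consequence for the informal proof plan of the crux: the entropy inequality
`∫ X df ≤ β⁻¹ [H(f|ψ) + log ∫ e^{βX} dψ]` is VOID (`+∞` on the right) for the energy-current term and for the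
cubic velocity tail `Σᵢ |vᵢ|³ 1(|vᵢ| > A)` under EVERY local Gibbs reference `ψ`; the "tail by a truncation
statement under f_t (GIVEN)" of the plan is therefore an a-priori estimate on the TRUE law that the entropy method
cannot supply (`Literature.Barriers.AtomisticToContinuum.HighMomentumCutoff`, OVY 1993 p. 525: bounded-gradient
kinetic energy; Nachtergaele–Yau 2003 Assumption II.1: "no proof even in the classical case"). [folklore] -/
theorem lintegral_exp_mul_pow_three_eq_top {α : ℝ} (hα : 0 < α) :
    ∫⁻ x, ENNReal.ofReal (Real.exp (α * x ^ 3)) ∂(ProbabilityTheory.gaussianReal 0 1) = ∞ := by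
  rw [ProbabilityTheory.gaussianReal_of_var_ne_zero 0 one_ne_zero,
    lintegral_withDensity_eq_lintegral_mul _ (ProbabilityTheory.measurable_gaussianPDF 0 1)
      (by fun_prop : Measurable fun x : ℝ => ENNReal.ofReal (Real.exp (α * x ^ 3)))]
  -- on `[R, ∞)`, `R = (2α)⁻¹`, the integrand is at least the constant `(√(2π))⁻¹`
  set R : ℝ := (2 * α)⁻¹ with hR
  have hRpos : 0 < R := by positivity
  set c : ℝ≥0∞ := ENNReal.ofReal ((Real.sqrt (2 * Real.pi))⁻¹) with hc
  have hcpos : c ≠ 0 := by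
    rw [hc]; exact (ENNReal.ofReal_pos.2 (inv_pos.2 (Real.sqrt_pos.2 (by positivity)))).ne'
  have hpt : ∀ x ∈ Set.Ici R, c ≤ (ProbabilityTheory.gaussianPDF 0 1 * fun x => ENNReal.ofReal
      (Real.exp (α * x ^ 3))) x := by
    intro x hx
    have hx0 : 0 < x := hRpos.trans_le hx
    simp only [Pi.mul_apply, ProbabilityTheory.gaussianPDF, ProbabilityTheory.gaussianPDFReal]
    rw [← ENNReal.ofReal_mul (by positivity)]
    refine ENNReal.ofReal_le_ofReal ?_
    have hsqrt : Real.sqrt (2 * Real.pi * ((1 : NNReal) : ℝ)) = Real.sqrt (2 * Real.pi) := by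
      rw [NNReal.coe_one, mul_one]
    rw [hsqrt, mul_assoc, ← Real.exp_add]
    have hexp : (0 : ℝ) ≤ -(x - 0) ^ 2 / (2 * ((1 : NNReal) : ℝ)) + α * x ^ 3 := by
      rw [NNReal.coe_one, mul_one, sub_zero]
      have hαx : 1 / 2 ≤ α * x := by
        have : (2 * α)⁻¹ ≤ x := hx
        rw [inv_le_iff_one_le_mul₀ (by positivity)] at this
        linarith
      have hx2 : 0 ≤ x ^ 2 := sq_nonneg x
      nlinarith
    have h1 : (1 : ℝ) ≤ Real.exp (-(x - 0) ^ 2 / (2 * ((1 : NNReal) : ℝ)) + α * x ^ 3) :=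
      Real.one_le_exp hexp
    have hs : 0 < (Real.sqrt (2 * Real.pi))⁻¹ := inv_pos.2 (Real.sqrt_pos.2 (by positivity))
    nlinarith
  refine eq_top_iff.2 ?_
  calc (⊤ : ℝ≥0∞) = c * volume (Set.Ici R) := by rw [Real.volume_Ici, ENNReal.mul_top hcpos]
    _ = ∫⁻ _ in Set.Ici R, c ∂(volume : Measure ℝ) := (setLIntegral_const _ _).symm
    _ ≤ ∫⁻ x in Set.Ici R, (ProbabilityTheory.gaussianPDF 0 1 * fun x => ENNReal.ofReal
        (Real.exp (α * x ^ 3))) x ∂volume := setLIntegral_mono' measurableSet_Ici hpt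
    _ ≤ _ := setLIntegral_le_lintegral _ _


end Summit.AtomisticToContinuum.HydrodynamicLimit.Theorems.KineticWindowGronwallNegative

end
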